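import Summits.QuantumFields.BalabanUV.Beta.EriceFlowEnclosureB12AsPrintedWitness
import Literature.MathematicalPhysics.QuantumFieldTheory.Balaban1983to89.BetaDerivClause

/-!
# Beta / EriceFlowEnclosureB12AsPrintedLastVar — row I1's necessity witness AT THE LEVEL OF THE AS-PRINTED INTERFACE OF [I], part 1: a
# family of β-functions whose last-variable sections satisfy p. 264's clause AS TYPED (`Conclusions.c264`, and the box-wide per-step schemata
# of `B12CouplingClausesHistory`) while EVERY k-uniform last-variable letter fails (β-flow team, prover 1, unit `b2b-balaban-beta-bflow-p1`,
# gen 32; ROW AP-I; PART 2 = `…B12AsPrintedLastVarEnd` (the runs, the toy setting, the headlines); companions `…B12AsPrintedUpper` §5 (the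
# positive per-step statement), `…B12AsPrintedWitness` (the kernel toolkit reused here))

HONEST FRAMING (page 1 of everything the β sub-cell writes): discharging `BetaPertH` makes Bałaban's UV stability UNCONDITIONAL — a
real constructive-QFT result; it is NOT the continuum limit and NOT the Clay problem.  HONEST DEPENDENCY (cell reorg 2026-08-19,
verbatim): «continuum YM on T⁴ ⇐ BetaPertH ∧ nine spine estimates (0/9 proved); BetaPertH ⇐ (D1) ∧ (D4) ∧ CAP+tail; G-an2-4 gates
asym, D1 and NE2/3/4.»  THIS MODULE DISCHARGES NOTHING: [folklore] calculus on ONE explicit family of functions of ours —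
β_{k+1}(g₀, …, g_k) := 1∕100 + 1∕100·φ(k·g_k), φ(t) = t∕(1 + t²) — read through the NAMED FIELDS of the statement-exact typing of [I] =
T. Bałaban, Commun. Math. Phys. **109** (1987) [Balaban1987RG1] (`B12BetaAsPrinted`, p537882 ✓ ∕ v1.1 p539116 ✓) and the tree's located
letters `BetaDerivClause.LastVarLipschitz` ∕ `LastVarLipschitzAtZero` (row I1 ∕ row an4's HYPOTHESES: the step- and history-UNIFORM reading of
p. 264 «uniformly bounded on this interval together with all derivatives», first order; GAPS G-b12-2).  Every statement here is about settings
`S` satisfying DEFINING HYPOTHESES (`hβ : S.β = the toy family`, `hγ : S.γ = 1`); nothing of Bałaban's β_{j+1} is asserted and the toy is not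
claimed to resemble it — β IS asserted smooth with k-uniform bounds in the cell's READING of p. 264; the point certified is only that the
AS-PRINTED conjunct (per j, no lettered constant — the typer's N-D4-4 ∕ DELTA-I D-10 reading) does not carry that uniformity.

WHAT THIS FILE PROVES (0 sorry, 0 def):
§1 `abs_profile_le` (|t∕(1+t²)| ≤ 1∕2), `profile_contDiff`, `toyBeta_contDiff`, `toyBeta_mem` (1∕200 ≤ β ≤ 3∕200), `toyBeta_iteratedDerivWithin_bounded`
   (every derivative bounded on [0, 1], PER slope parameter: compactness + `ContDiffOn.continuousOn_iteratedDerivWithin`), `abs_toyBeta_le`,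
   `rep537_diag`, `expBound_zero`.
§2 UNDER THE DEFINING HYPOTHESIS `hβ`: `section_eq_of_toyBeta` ∕ `lastSection_eq_of_toyBeta`; **`c264_of_toyBeta`** (the β-clause of p. 264 AS
   TYPED holds: smooth, every derivative bounded per step — the bound at order 1 is ≍ k); `betaSmoothInLast264_of_toyBeta`,
   `betaDerivsBoundedInLast264_of_toyBeta` (the box-wide per-step schemata hold too); `toyBeta_jump` (β_{k+1} moves by 1∕200 between g_k = 0 and
   g_k = 1∕k); **`not_lastVarLipschitz_of_toyBeta`** (∀ C, ¬`LastVarLipschitz S.β C γ`), **`not_lastVarLipschitzAtZero_of_toyBeta`** (∀ C, ¬(AF-1)'s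
   letter), **`not_uniform_lipschitz_of_toyBeta`** (no Lipschitz constant uniform along the runs Theorem 3 speaks of, given such runs at every
   depth — PART 2 builds them).
NOT CLAIMED: anything about Bałaban's β; that the toy is a lattice object; `BetaPertH`; continuum; Clay.
-/

namespace Summit.QuantumFields.BalabanUV.Beta.EriceFlowEnclosureB12AsPrintedLastVar

open Literature.MathematicalPhysics.QuantumFieldTheory.GawedzkiKupiainen1985.PeriodicGleason (Pt delta unitVec ExpBound wt wt_pos)
open Literature.MathematicalPhysics.QuantumFieldTheory.Balaban1983to89
open Literature.MathematicalPhysics.QuantumFieldTheory.Balaban1983to89.B12Rep537 (wilsonQ MQ)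
open Literature.MathematicalPhysics.QuantumFieldTheory.Balaban1983to89.B12BetaAsPrinted
open Literature.MathematicalPhysics.QuantumFieldTheory.Balaban1983to89.FlowStep (prefixOf Box BetaContH BetaLowerH BetaUpperH)
open Literature.MathematicalPhysics.QuantumFieldTheory.Balaban1983to89.BetaDerivClause (LastVarLipschitz LastVarLipschitzAtZero)
open Literature.MathematicalPhysics.QuantumFieldTheory.Balaban1983to89.B12CouplingClausesHistory (BetaSmoothInLast264
  BetaDerivsBoundedInLast264)
open Summit.QuantumFields.BalabanUV.Beta.EriceFlowEnclosureB12AsPrintedMarginal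
open Summit.QuantumFields.BalabanUV.Beta.EriceFlowEnclosureB12AsPrintedWitness

noncomputable section

/-! ## §1 The profile t ↦ t∕(1 + t²) and the toy β-function b + b·φ(k·s), b = 1∕100 -/

/-- `|t∕(1 + t²)| ≤ 1∕2` ((|t| − 1)² ≥ 0). [folklore] -/
theorem abs_profile_le (t : ℝ) : |t / (1 + t ^ 2)| ≤ 1 / 2 := by
  have hpos : 0 < 1 + t ^ 2 := by positivity
  rw [abs_div, abs_of_pos hpos, div_le_iff₀ hpos]
  nlinarith [sq_nonneg (|t| - 1), sq_abs t, abs_nonneg t]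

/-- Smoothness of `s ↦ a·s∕(1 + (a·s)²)` (a rational function with non-vanishing denominator). [folklore] -/
theorem profile_contDiff (a : ℝ) {n : WithTop ℕ∞} : ContDiff ℝ n (fun s : ℝ => a * s / (1 + (a * s) ^ 2)) :=
  (contDiff_const.mul contDiff_id).div (contDiff_const.add ((contDiff_const.mul contDiff_id).pow 2))
    fun s => by positivity

/-- Smoothness of the toy last-variable section `s ↦ 1∕100 + 1∕100·(a·s∕(1 + (a·s)²))`. [folklore] -/
theorem toyBeta_contDiff (a : ℝ) {n : WithTop ℕ∞} :
    ContDiff ℝ n (fun s : ℝ => 1 / 100 + 1 / 100 * (a * s / (1 + (a * s) ^ 2))) :=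
  contDiff_const.add (contDiff_const.mul (profile_contDiff a))

/-- The toy β-function is squeezed in [1∕200, 3∕200]. [folklore] -/
theorem toyBeta_mem (a s : ℝ) :
    1 / 200 ≤ 1 / 100 + 1 / 100 * (a * s / (1 + (a * s) ^ 2)) ∧ 1 / 100 + 1 / 100 * (a * s / (1 + (a * s) ^ 2)) ≤ 3 / 200 := by
  have h := abs_profile_le (a * s)
  rw [abs_le] at h
  constructor <;> linarith [h.1, h.2]

/-- Every derivative of the toy section is bounded on [0, 1] (smooth on a compact interval with unique tangents). [folklore] -/
theorem toyBeta_iteratedDerivWithin_bounded (a : ℝ) (n : ℕ) :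
    ∃ B : ℝ, ∀ s ∈ Set.Icc (0 : ℝ) 1,
      ‖iteratedDerivWithin n (fun s : ℝ => 1 / 100 + 1 / 100 * (a * s / (1 + (a * s) ^ 2))) (Set.Icc 0 1) s‖ ≤ B := by
  have hc : ContinuousOn (iteratedDerivWithin n (fun s : ℝ => 1 / 100 + 1 / 100 * (a * s / (1 + (a * s) ^ 2))) (Set.Icc 0 1))
      (Set.Icc 0 1) :=
    ((toyBeta_contDiff a (n := n)).contDiffOn).continuousOn_iteratedDerivWithin le_rfl uniqueDiffOn_Icc_zero_one
  exact isCompact_Icc.exists_bound_of_continuousOn hc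

/-! ## §2 Settings whose β-functions are the toy sections: the clause of p. 264 AS PRINTED holds, its uniform readings fail -/

variable {S : Setting}

/-- Under the defining hypothesis `β_{k+1}(g₀, …, g_k) = 1∕100 + 1∕100·φ(k·g_k)`, the last-variable section of β along ANY history is the toy
section with slope parameter k. [folklore] -/
theorem section_eq_of_toyBeta
    (hβ : ∀ (k : ℕ) (p : Fin (k + 1) → ℝ), S.β k p =
      1 / 100 + 1 / 100 * ((k : ℝ) * p (Fin.last k) / (1 + ((k : ℝ) * p (Fin.last k)) ^ 2)))
    (k : ℕ) (p : Fin (k + 1) → ℝ) :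
    (fun s : ℝ => S.β k (Function.update p (Fin.last k) s)) =
      fun s : ℝ => 1 / 100 + 1 / 100 * ((k : ℝ) * s / (1 + ((k : ℝ) * s) ^ 2)) := by
  funext s; rw [hβ, Function.update_self]

/-- … in particular along a run (`lastSection`). [folklore] -/
theorem lastSection_eq_of_toyBeta
    (hβ : ∀ (k : ℕ) (p : Fin (k + 1) → ℝ), S.β k p =
      1 / 100 + 1 / 100 * ((k : ℝ) * p (Fin.last k) / (1 + ((k : ℝ) * p (Fin.last k)) ^ 2)))
    (P : B12.RunParams) (j : ℕ) :
    lastSection S P j = fun s : ℝ => 1 / 100 + 1 / 100 * ((j : ℝ) * s / (1 + ((j : ℝ) * s) ^ 2)) :=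
  section_eq_of_toyBeta hβ j (prefixOf (S.cpl P) j)

/-- **THE β-CLAUSE OF p. 264 AS PRINTED (`Conclusions.c264`) HOLDS for such a setting** with γ = 1 and the p. 266 cut-off flag off:
smooth on [0, γ], every derivative bounded on [0, γ] PER STEP (with a step-DEPENDENT bound — the derivative at 0 is j∕100).
[cite: Balaban1987RG1, p.264 (β-clause after (1.22))] -/
theorem c264_of_toyBeta
    (hβ : ∀ (k : ℕ) (p : Fin (k + 1) → ℝ), S.β k p =
      1 / 100 + 1 / 100 * ((k : ℝ) * p (Fin.last k) / (1 + ((k : ℝ) * p (Fin.last k)) ^ 2)))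
    (hγ : S.γ = 1) (halt : ¬ S.altCutoff266) (P : B12.RunParams) (_hP : RunHyp S P) (j : ℕ) (_hj : j + 1 ≤ P.K) :
    (∀ n : ℕ, ContDiffOn ℝ n (lastSection S P j) (Set.Icc 0 S.γ)) ∧
      (S.altCutoff266 → AnalyticOn ℝ (lastSection S P j) (Set.Icc 0 S.γ)) ∧
      (∀ n : ℕ, ∃ B : ℝ, ∀ s ∈ Set.Icc (0 : ℝ) S.γ, ‖iteratedDerivWithin n (lastSection S P j) (Set.Icc 0 S.γ) s‖ ≤ B) := by
  rw [lastSection_eq_of_toyBeta hβ, hγ]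
  exact ⟨fun n => (toyBeta_contDiff (j : ℝ)).contDiffOn, fun h => (halt h).elim,
    fun n => toyBeta_iteratedDerivWithin_bounded (j : ℝ) n⟩

/-- The box-wide PER-STEP smoothness schema `B12CouplingClausesHistory.BetaSmoothInLast264` holds as well (every frozen history, not only
run prefixes). [cite: Balaban1987RG1, p.264 (β-clause after (1.22))] -/
theorem betaSmoothInLast264_of_toyBeta
    (hβ : ∀ (k : ℕ) (p : Fin (k + 1) → ℝ), S.β k p =
      1 / 100 + 1 / 100 * ((k : ℝ) * p (Fin.last k) / (1 + ((k : ℝ) * p (Fin.last k)) ^ 2))) :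
    BetaSmoothInLast264 S.γ S.β := by
  intro k p _ n
  rw [section_eq_of_toyBeta hβ]
  exact (toyBeta_contDiff (k : ℝ)).contDiffOn

/-- … and the box-wide PER-STEP derivative-bound schema `BetaDerivsBoundedInLast264` (γ = 1). [cite: Balaban1987RG1, p.264 (β-clause after (1.22))] -/
theorem betaDerivsBoundedInLast264_of_toyBeta
    (hβ : ∀ (k : ℕ) (p : Fin (k + 1) → ℝ), S.β k p =
      1 / 100 + 1 / 100 * ((k : ℝ) * p (Fin.last k) / (1 + ((k : ℝ) * p (Fin.last k)) ^ 2)))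
    (hγ : S.γ = 1) : BetaDerivsBoundedInLast264 S.γ S.β := by
  intro k p _ n
  rw [section_eq_of_toyBeta hβ, hγ]
  exact toyBeta_iteratedDerivWithin_bounded (k : ℝ) n

/-- The arithmetic of the witness: at step k the section moves by 1∕200 between s = 0 and s = 1∕k. [folklore] -/
theorem toyBeta_jump {k : ℕ} (hk : k ≠ 0) :
    (1 / 100 + 1 / 100 * ((k : ℝ) * (1 / (k : ℝ)) / (1 + ((k : ℝ) * (1 / (k : ℝ))) ^ 2))) -
      (1 / 100 + 1 / 100 * ((k : ℝ) * 0 / (1 + ((k : ℝ) * 0) ^ 2))) = 1 / 200 := by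
  have hk' : (k : ℝ) ≠ 0 := by exact_mod_cast hk
  rw [mul_one_div_cancel hk']
  norm_num

/-- **THE k-UNIFORM LIPSCHITZ CLAUSE IN THE LAST VARIABLE FAILS** (`BetaDerivClause.LastVarLipschitz`, row I1's located hypothesis = the
HISTORY- AND STEP-UNIFORM reading of p. 264's «uniformly bounded … together with all derivatives», first order): for every C, at the
step k = ⌊200C⌋ + 1 the history (1, …, 1) with last coupling moved from 0 to 1∕k changes β_{k+1} by 1∕200 > C·(1∕k).
[cite: Balaban1987RG1, p.264 (β-clause after (1.22))] -/
theorem not_lastVarLipschitz_of_toyBeta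
    (hβ : ∀ (k : ℕ) (p : Fin (k + 1) → ℝ), S.β k p =
      1 / 100 + 1 / 100 * ((k : ℝ) * p (Fin.last k) / (1 + ((k : ℝ) * p (Fin.last k)) ^ 2)))
    (hγ : S.γ = 1) (C : ℝ) : ¬ LastVarLipschitz S.β C S.γ := by
  intro h
  set k : ℕ := ⌊200 * C⌋₊ + 1 with hkdef
  have hk0 : k ≠ 0 := Nat.succ_ne_zero _
  have hkC : 200 * C < k := by rw [hkdef]; push_cast; exact Nat.lt_floor_add_one _
  have hkpos : (0 : ℝ) < k := by exact_mod_cast Nat.pos_of_ne_zero hk0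
  have hk1 : (1 : ℝ) ≤ k := by exact_mod_cast Nat.one_le_iff_ne_zero.mpr hk0
  have hp : (fun _ : Fin (k + 1) => (1 : ℝ)) ∈ B12Beta.HistBox S.γ k := fun _ => ⟨one_pos, by rw [hγ]⟩
  have ht : (1 / (k : ℝ)) ∈ Set.Icc (0 : ℝ) S.γ := by
    rw [hγ]; exact ⟨by positivity, (div_le_one hkpos).mpr hk1⟩
  have hs : (0 : ℝ) ∈ Set.Icc (0 : ℝ) S.γ := by rw [hγ]; exact ⟨le_rfl, zero_le_one⟩
  have hh := h k _ hp 0 (1 / (k : ℝ)) hs ht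
  have e := congrFun (section_eq_of_toyBeta hβ k (fun _ : Fin (k + 1) => (1 : ℝ)))
  rw [e (1 / (k : ℝ)), e 0, toyBeta_jump hk0, sub_zero, abs_of_pos (by positivity : (0 : ℝ) < 1 / k)] at hh
  rw [abs_of_pos (by norm_num : (0 : ℝ) < 1 / 200)] at hh
  have : (k : ℝ) / 200 ≤ C := by
    have := mul_le_mul_of_nonneg_right hh hkpos.le
    rw [mul_assoc, one_div_mul_cancel hkpos.ne', mul_one] at this
    linarith
  linarith

/-- **THE (AF-1)-TYPE LETTER `LastVarLipschitzAtZero` FAILS TOO** (|β_{k+1}(…, g_k) − β_{k+1}(…, 0)| ≤ C·g_k uniformly in k): same step,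
history (1, …, 1, 1∕k). [cite: Balaban1987RG1, p.264 (β-clause after (1.22)) with (2.13)–(2.14) p.268] -/
theorem not_lastVarLipschitzAtZero_of_toyBeta
    (hβ : ∀ (k : ℕ) (p : Fin (k + 1) → ℝ), S.β k p =
      1 / 100 + 1 / 100 * ((k : ℝ) * p (Fin.last k) / (1 + ((k : ℝ) * p (Fin.last k)) ^ 2)))
    (hγ : S.γ = 1) (C : ℝ) : ¬ LastVarLipschitzAtZero S.β C S.γ := by
  intro h
  set k : ℕ := ⌊200 * C⌋₊ + 1 with hkdef
  have hk0 : k ≠ 0 := Nat.succ_ne_zero _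
  have hkC : 200 * C < k := by rw [hkdef]; push_cast; exact Nat.lt_floor_add_one _
  have hkpos : (0 : ℝ) < k := by exact_mod_cast Nat.pos_of_ne_zero hk0
  have hk1 : (1 : ℝ) ≤ k := by exact_mod_cast Nat.one_le_iff_ne_zero.mpr hk0
  have hp : Function.update (fun _ : Fin (k + 1) => (1 : ℝ)) (Fin.last k) (1 / (k : ℝ)) ∈ B12Beta.HistBox S.γ k := by
    intro i
    by_cases hi : i = Fin.last k
    · subst hi; rw [Function.update_self, hγ]; exact ⟨by positivity, (div_le_one hkpos).mpr hk1⟩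
    · rw [Function.update_of_ne hi, hγ]; exact ⟨one_pos, le_rfl⟩
  have hh := h k _ hp
  rw [Function.update_idem, Function.update_self] at hh
  have e := congrFun (section_eq_of_toyBeta hβ k (fun _ : Fin (k + 1) => (1 : ℝ)))
  rw [e (1 / (k : ℝ)), e 0, toyBeta_jump hk0, abs_of_pos (by norm_num : (0 : ℝ) < 1 / 200)] at hh
  have : (k : ℝ) / 200 ≤ C := by
    have := mul_le_mul_of_nonneg_right hh hkpos.le
    rw [mul_assoc, one_div_mul_cancel hkpos.ne', mul_one] at this
    linarith
  linarith

/-- **NO LIPSCHITZ CONSTANT IN THE LAST VARIABLE UNIFORM ALONG THE RUNS THEOREM 3 SPEAKS OF** — the negation of the uniform reading at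
run level (compare `EriceFlowEnclosureB12AsPrintedUpper.lastSection_lipschitzOnWith`: per step and per run a constant exists): provided the
setting has, for every j, a run satisfying Theorem 3's hypothesis that reaches step j + 1. [cite: Balaban1987RG1, p.264 (β-clause after (1.22)) with Thm 3 p.264] -/
theorem not_uniform_lipschitz_of_toyBeta
    (hβ : ∀ (k : ℕ) (p : Fin (k + 1) → ℝ), S.β k p =
      1 / 100 + 1 / 100 * ((k : ℝ) * p (Fin.last k) / (1 + ((k : ℝ) * p (Fin.last k)) ^ 2)))
    (hγ : S.γ = 1) (hruns : ∀ j : ℕ, ∃ P : B12.RunParams, RunHyp S P ∧ P.K = j + 1) :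
    ¬ ∃ C : NNReal, ∀ (P : B12.RunParams) (j : ℕ), RunHyp S P → j + 1 ≤ P.K →
      LipschitzOnWith C (lastSection S P j) (Set.Icc 0 S.γ) := by
  rintro ⟨C, hC⟩
  set k : ℕ := ⌊200 * (C : ℝ)⌋₊ + 1 with hkdef
  have hk0 : k ≠ 0 := Nat.succ_ne_zero _
  have hkC : 200 * (C : ℝ) < k := by rw [hkdef]; push_cast; exact Nat.lt_floor_add_one _
  have hkpos : (0 : ℝ) < k := by exact_mod_cast Nat.pos_of_ne_zero hk0
  have hk1 : (1 : ℝ) ≤ k := by exact_mod_cast Nat.one_le_iff_ne_zero.mpr hk0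
  obtain ⟨P, hP, hK⟩ := hruns k
  have hL := hC P k hP (by rw [hK])
  have ht : (1 / (k : ℝ)) ∈ Set.Icc (0 : ℝ) S.γ := by
    rw [hγ]; exact ⟨by positivity, (div_le_one hkpos).mpr hk1⟩
  have hs : (0 : ℝ) ∈ Set.Icc (0 : ℝ) S.γ := by rw [hγ]; exact ⟨le_rfl, zero_le_one⟩
  have hd := hL.dist_le_mul (1 / (k : ℝ)) ht 0 hs
  rw [lastSection_eq_of_toyBeta hβ, Real.dist_eq, Real.dist_eq, toyBeta_jump hk0, sub_zero,
    abs_of_pos (by norm_num : (0 : ℝ) < 1 / 200), abs_of_pos (by positivity : (0 : ℝ) < 1 / k)] at hd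
  have : (k : ℝ) / 200 ≤ C := by
    have := mul_le_mul_of_nonneg_right hd hkpos.le
    rw [mul_assoc, one_div_mul_cancel hkpos.ne', mul_one] at this
    linarith
  linarith

/-- `|1∕100 + 1∕100·φ(a·t)| ≤ 3∕200` and `|1∕100·φ(a·t)| ≤ 1∕200` (the (1.18)-slot bounds of the toy, any a, t). [folklore] -/
theorem abs_toyBeta_le (a t : ℝ) :
    |1 / 100 + 1 / 100 * (a * t / (1 + (a * t) ^ 2))| ≤ 3 / 200 ∧ |1 / 100 * (a * t / (1 + (a * t) ^ 2))| ≤ 1 / 200 := by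
  have h := abs_profile_le (a * t)
  rw [abs_le] at h
  constructor
  · rw [abs_le]; constructor <;> linarith [h.1, h.2]
  · rw [abs_mul, abs_of_pos (by norm_num : (0 : ℝ) < 1 / 100)]; linarith [abs_profile_le (a * t)]

/-- (5.37)∕(5.38) on the diagonal is empty for the toy kernels: `c·Re Q_{μμ} − c·Q_{μμ} = 0 = Σ_w D_w 0`. [folklore] -/
theorem rep537_diag (c : ℝ) (μ : Fin 4) (x : Pt 4) :
    (((c * (wilsonQ μ μ x).re : ℝ)) : ℂ) - (c : ℂ) * wilsonQ μ μ x = ∑ w : Fin 3 → Fin 4 × Bool, diffWord w (fun _ : Pt 4 => (0 : ℂ)) x := by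
  simp only [diffWord_zero, Finset.sum_const_zero]
  push_cast
  rw [wilsonQ_re_coe, sub_self]

/-- The zero kernel is exponentially bounded with any nonnegative constant. [folklore] -/
theorem expBound_zero {d : ℕ} (a M : ℝ) (hM : 0 ≤ M) : ExpBound a M (fun _ : Pt d => (0 : ℂ)) :=
  fun y => by rw [norm_zero]; exact mul_nonneg hM (le_of_lt (wt_pos a y))

end

end Summit.QuantumFields.BalabanUV.Beta.EriceFlowEnclosureB12AsPrintedLastVar
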